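import Literature.NumberTheory.EllipticCurves.LocalRestrictionUnramifiedDescentProofs
import Literature.NumberTheory.EllipticCurves.UnramifiedClassTamagawaTorsion
import Literature.NumberTheory.EllipticCurves.SelmerTorsionRelModelAction
import Literature.NumberTheory.EllipticCurves.ArchimedeanLocalCondition
import HarnessLib

/-!
# Exact descent of the `n`-Selmer condition along `L/K`: the global assembly from local kernels,
# unramified places of BAD reduction with `gcd(n, c_v) = 1`, and places where `E(L̃_w)` is
# `n`-divisible without `n`-torsion

`Proofs` file (theorems only: no definition, no named fact, no instance) in topic
`NumberTheory/EllipticCurves`, continuing ty2's `LocalRestrictionUnramifiedDescentProofs` (split places;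
unramified places of GOOD reduction, Milne *ADT* I Prop. 3.8). For a Weierstrass curve `W` (an elliptic
curve `E`) over a number field `K`, a `K`-field `L` and `n : ℤ`:

* §1 (generic group cohomology, the tree's `cocyclesVanishingOn` / `inflClass` model of inflation):
  `inflClass_eq_zero_of_zsmul_eq_zero_of_fixedPoints` — for an open normal subgroup `N ≤ G` and a
  discrete `G`-module `M` whose `N`-invariants `M^N` are `n`-TORSION-FREE and `n`-DIVISIBLE, an inflated
  class killed by `n` is zero (`H¹(G/N, M^N)[n] = 0`: multiplication by `n` is bijective on `M^N`);
  (private) a class killed by coprime `a`, `b` is zero.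
* §2 (abstract local, a tower of `K`-fields `K → E → E'`):
  `mem_localRestrictionKer_of_tower_of_inertia_le_of_isCoprime` — **bad reduction allowed**: if the
  local inertia group `I_𝔐 ≤ Γ_{K_v}` fixes every copy of `E' ⊇ K_v` (`E'/K_v` unramified) then a class
  `c ∈ H¹(K, E)` killed by `m` with `gcd(m, c_v) = 1`, `c_v = [E(K_v) : E₀(K_v)]` the local Tamagawa
  number, dying in `H¹(E', E)` dies in `H¹(K_v, E)` — GRANTED Milne *ADT* I Prop. 3.8 in Tamagawa form
  (`c_v` kills unramified classes; the tree's named fact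
  `Milne2006_localTamagawaNumber_smul_unramifiedClass_eq_zero`, DISCHARGED Summits-side by
  `MilneTamagawa.Milne2006_localTamagawaNumber_smul_unramifiedClass_eq_zero_holds`, taken here as the
  hypothesis `h38`); `mem_localRestrictionKer_of_tower_of_fixedPoints_divisible` — ANY ramification: if
  `E(K̄_E)^{Γ_{Ẽ'}}` is `n`-torsion-free and `n`-divisible then an `n`-torsion class dying in `H¹(E', E)`
  dies in `H¹(E, E)` (§1).
* §3 (number fields, `L = K + K θ`, `θ² = c ∈ K`, normal over `K`, `w ∣ v` finite):
  `mem_localRestrictionKer_adicCompletion_of_isUnramifiedIn_of_isCoprime` (**`v` unramified in `L`, any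
  reduction, `gcd(m, c_v) = 1`**) and `mem_localRestrictionKer_adicCompletion_of_fixedPoints_divisible`
  (**any `v`, granted the divisibility / torsion-freeness of `E(K̄_v)^{Γ_{L̃_w}}`** — at a place
  `w ∤ n` with `E(L_w)[n] = 0` this is Milne *ADT* I Lemma 3.3, `#E(L_w)/n = #E(L_w)[n]·#𝓞_w/n`).
* §4 (global): `mem_selmerGroup_of_resTorsion_mem_of_forall` — for `K` totally complex, a class
  `x ∈ H¹(K, E[n])` whose restriction lies in `Sel^(n)(E_L/L)` lies in `Sel^(n)(E/K)` as soon as, at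
  every finite place `v`, some `w ∣ v` has "dies over `L_w` ⟹ dies over `K_v`" for the image of `x` in
  `H¹(K, E)`; `mem_selmerGroup_iff_resTorsion_mem_of_forall` (with `resTorsion_mem_selmerGroup`).

These are the local terms of Dokchitser–Dokchitser's "kernel and cokernel of `Sel(E/K) → Sel(E/F)^G`
killed by `|G|²`" (Ann. of Math. 172 (2010), proof of Lemma 4.14) at the places where they VANISH,
and the exact-descent binder `hdesc` of the Selmer descent interface of the BSD cell `bsd-print-cf2`
(`Summits/BirchSwinnertonDyer/Rank1Residual/P2/CMKolyvaginSelmerDescentAtTwo.lean`). Everything here is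
proved; no named fact is introduced (Milne I.3.8 in Tamagawa form enters as a HYPOTHESIS).

## References

* J. S. Milne, *Arithmetic Duality Theorems*, 2nd ed. (2006), Ch. I Lemma 3.3, Prop. 3.8, §6.
  [MilneADT2006]
* T. Dokchitser, V. Dokchitser, Ann. of Math. 172 (2010), Lemma 4.14 (proof).
  [DokchitserDokchitserAnnals2010]
* J.-P. Serre, *Galois Cohomology* (1997), I.§2.4, I.§2.6 (b), I.§5.8. [SerreGaloisCohomology1997]
* B. Mazur, *Rational points of abelian varieties with values in towers of number fields*, Invent.
  Math. 18 (1972), §4 (the local norm index at bad unramified places is controlled by `c_v`).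
  [Mazur1972]
-/

noncomputable section

open scoped Classical

universe u v

namespace Literature.NumberTheory.EllipticCurves

open GaloisRepresentations NumberField Field
open _root_.WeierstrassCurve
open IsDedekindDomain (HeightOneSpectrum)

/-! ## §1 Generic: `H¹(G/N, M^N)[n] = 0` when `M^N` is uniquely `n`-divisible; coprime killers -/

section Generic

variable {G : Type u} [Group G] [TopologicalSpace G] [IsTopologicalGroup G]
variable {M : Type u} [AddCommGroup M] [DistribMulAction G M] [TopologicalSpace M]
  [DiscreteTopology M]

/-- **An inflated class killed by `n` vanishes when `M^N` is `n`-torsion-free and `n`-divisible.**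
Let `N ≤ G` be open and normal and `f : G → M` a crossed homomorphism vanishing on `N` (values in
`M^N`). If `n • [f] = 0` in `H¹(G, M)`, i.e. `n f(g) = g P - P`, then `P ∈ M^N` (take `g ∈ N`), so
`P = n Q` with `Q ∈ M^N` (divisibility) and `n (f(g) - (g Q - Q)) = 0` with `f(g) - (g Q - Q) ∈ M^N`,
whence `f(g) = g Q - Q` (no `n`-torsion): `[f] = 0`. (Multiplication by `n` is an automorphism of the
`G/N`-module `M^N`, hence of `H¹(G/N, M^N)`.) [cite: SerreGaloisCohomology1997, I.§2.6 (b)] -/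
theorem inflClass_eq_zero_of_zsmul_eq_zero_of_fixedPoints (N : Subgroup G) [hN' : N.Normal]
    (hN : IsOpen (N : Set G)) {n : ℤ}
    (htf : ∀ a : M, (∀ m ∈ N, m • a = a) → n • a = 0 → a = 0)
    (hdiv : ∀ a : M, (∀ m ∈ N, m • a = a) → ∃ b : M, (∀ m ∈ N, m • b = b) ∧ n • b = a)
    (f : cocyclesVanishingOn M N) (hf : n • inflClass M N hN f = 0) :
    inflClass M N hN f = 0 := by
  rw [← map_zsmul, inflClass_apply, GaloisRepresentations.oneCocycleClass_eq_zero_iff] at hf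
  obtain ⟨P, hP⟩ := hf
  have hP' : ∀ g : G, n • f.1 g = g • P - P := fun g ↦ by
    have h := hP g
    rw [toContOneCocycle_apply, discreteTopRep_ρ_apply] at h
    exact h
  -- `P` is `N`-invariant
  have hPN : ∀ m ∈ N, m • P = P := fun m hm ↦ by
    have h := hP' m
    rw [cocyclesVanishingOn.apply_of_mem f hm, smul_zero] at h
    exact sub_eq_zero.mp h.symm
  obtain ⟨Q, hQN, hQ⟩ := hdiv P hPN
  -- `f(g) = g Q - Q`
  have hfg : ∀ g : G, f.1 g = g • Q - Q := fun g ↦ by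
    have hinv : ∀ m ∈ N, m • (f.1 g - (g • Q - Q)) = f.1 g - (g • Q - Q) := fun m hm ↦ by
      have hconj : g⁻¹ * m * g ∈ N := by
        have := hN'.conj_mem m hm g⁻¹
        rwa [inv_inv] at this
      rw [smul_sub, smul_sub, cocyclesVanishingOn.smul_apply f g hm, hQN m hm, smul_smul,
        show m * g = g * (g⁻¹ * m * g) by group, ← smul_smul, hQN _ hconj]
    have hcomm : g • (n • Q) = n • (g • Q) := map_zsmul (DistribSMul.toAddMonoidHom M g) n Q
    have hn0 : n • (f.1 g - (g • Q - Q)) = 0 := by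
      rw [zsmul_sub, hP' g, ← hQ, hcomm, zsmul_sub, sub_self]
    exact sub_eq_zero.mp (htf _ hinv hn0)
  rw [inflClass_apply, GaloisRepresentations.oneCocycleClass_eq_zero_iff]
  exact ⟨Q, fun g ↦ by rw [toContOneCocycle_apply, discreteTopRep_ρ_apply, hfg]⟩

omit [TopologicalSpace G] [IsTopologicalGroup G] [DistribMulAction G M] [TopologicalSpace M]
  [DiscreteTopology M] in
/-- An element killed by two coprime integers is zero. [folklore] -/
private theorem eq_zero_of_zsmul_eq_zero_of_isCoprime {A : Type v} [AddCommGroup A] {a b : ℤ}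
    (h : IsCoprime a b) {x : A} (ha : a • x = 0) (hb : b • x = 0) : x = 0 := by
  obtain ⟨u, w, huw⟩ := h
  calc x = (1 : ℤ) • x := (one_zsmul x).symm
    _ = (u * a + w * b) • x := by rw [huw]
    _ = 0 := by rw [add_zsmul, mul_zsmul, mul_zsmul, ha, hb, zsmul_zero, zsmul_zero, add_zero]

end Generic

/-! ## §2 Abstract local descent along a tower `K → E → E'` -/

section Abstract

variable {K : Type u} [Field K] (W : WeierstrassCurve K)
variable {E : Type u} [Field E] [Algebra K E]
variable {E' : Type u} [Field E'] [Algebra K E'] [Algebra E E'] [IsScalarTower K E E']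
variable [FiniteDimensional E E'] [CharZero E]

variable {W} in
/-- **Exact descent when the `Γ_{Ẽ'}`-invariants of `E(K̄_E)` are uniquely `n`-divisible.** For a tower
of `K`-fields `K → E → E'` with `E'/E` finite, suppose the points of `E(K̄_E)` fixed by `Γ_{Ẽ'}`
(`finGalSubgroup E'`, the Galois closure `Ẽ'` of `E'/E`; these are the `Ẽ'`-rational points) have NO
`n`-torsion and are `n`-DIVISIBLE within themselves. Then a class `c ∈ H¹(K, E)` killed by `n` and dying
in `H¹(E', E)` dies in `H¹(E, E)`: its image in `H¹(E, E)` is inflated from `Gal(Ẽ'/E)`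
(`resKer_le_range_inflClass`) and `H¹(Gal(Ẽ'/E), E(Ẽ'))[n] = 0` (§1). (At a completion `E = K_v`,
`E' = L_w` with `w ∤ n` and `E(L_w)[n] = 0`: `E(L_w)/n = 0` by Milne I Lemma 3.3.)
[cite: MilneADT2006, Ch. I Lemma 3.3] [cite: SerreGaloisCohomology1997, I.§5.8] -/
theorem mem_localRestrictionKer_of_tower_of_fixedPoints_divisible {n : ℤ}
    (htf : ∀ a : localPoints W E, (∀ m ∈ finGalSubgroup (E := E) E', m • a = a) → n • a = 0 → a = 0)
    (hdiv : ∀ a : localPoints W E, (∀ m ∈ finGalSubgroup (E := E) E', m • a = a) →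
      ∃ b : localPoints W E, (∀ m ∈ finGalSubgroup (E := E) E', m • b = b) ∧ n • b = a)
    {c : W.galH1} (hnc : n • c = 0) (hc : c ∈ W.localRestrictionKer E') :
    c ∈ W.localRestrictionKer E := by
  haveI : (finGalSubgroup (E := E) E').Normal := by
    haveI : IsGalois E (AlgebraicClosure E) := {}
    exact (InfiniteGalois.normal_iff_isGalois _).mpr (inferInstance : IsGalois E (finGaloisClosure (E := E) E'))
  let ι₁ : AlgebraicClosure K →ₐ[K] AlgebraicClosure E := closureEmb (K := K) E
  let ι₂ : AlgebraicClosure E →ₐ[E] AlgebraicClosure E' := closureEmb (K := E) E'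
  rw [← WeierstrassCurve.localRestrictionKerOfEmb_eq_holds W E' ((ι₂.restrictScalars K).comp ι₁)] at hc
  change c ∈ resKer (resGalOfEmb ((ι₂.restrictScalars K).comp ι₁))
    (pointsMapOfEmb W ((ι₂.restrictScalars K).comp ι₁)) (pointsMapOfEmb_smul W _) at hc
  rw [resKer_eq_ker, AddMonoidHom.mem_ker,
    resH1Hom_congr (resGalOfEmb_comp_tower ι₁ ι₂) (pointsMapOfEmb_comp_tower W ι₁ ι₂) _
      (fun x m ↦ by
        simp only [ContinuousMonoidHom.comp_toFun, AddMonoidHom.coe_comp, Function.comp_apply,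
          pointsMapOfEmb_smul, pointsMapTower_smul]),
    ← resH1Hom_comp (resGalOfEmb ι₁) (pointsMapOfEmb W ι₁) (pointsMapOfEmb_smul W ι₁)
      (resGalOfEmb (K := E) ι₂) _ (pointsMapTower_smul W ι₂), AddMonoidHom.comp_apply,
    ← AddMonoidHom.mem_ker, ← resKer_eq_ker] at hc
  obtain ⟨f, hf⟩ := resKer_le_range_inflClass (resGalOfEmb (K := E) ι₂)
    (pointsMapTower W ι₂) (pointsMapTower_smul W ι₂) (pointsMapTower_bijective W ι₂)
    (finGalSubgroup (E := E) E') (isOpen_finGalSubgroup E')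
    (finGalSubgroup_le_range_resGal E') hc
  -- the inflated class is killed by `n`
  have hn : n • inflClass (localPoints W E) (finGalSubgroup (E := E) E') (isOpen_finGalSubgroup E') f = 0 := by
    rw [hf, ← map_zsmul, hnc, map_zero]
  have h0 := inflClass_eq_zero_of_zsmul_eq_zero_of_fixedPoints (finGalSubgroup (E := E) E')
    (isOpen_finGalSubgroup E') htf hdiv f hn
  change resH1Hom (resGalOfEmb ι₁) (pointsMapOfEmb W ι₁) (pointsMapOfEmb_smul W ι₁) c = 0
  rw [← hf, h0]

variable {W} in
/-- **Exact descent at an unramified place of ANY reduction for classes of order prime to the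
Tamagawa number** (Milne, *ADT* I Prop. 3.8 in Tamagawa form). Let `W/K` be an elliptic curve over a
number field, `v` a finite place, `E' ⊇ K_v` a finite extension of the completion with the local inertia
group `I_𝔐 ≤ Γ_{K_v}` fixing every copy of `E'` (`E'/K_v` unramified), and `c ∈ H¹(K, E)` killed by an
integer `m` coprime to the local Tamagawa number `c_v = [E(K_v) : E₀(K_v)]`. GRANTED that `c_v` kills
every class of `H¹(K_v, E)` whose cocycle vanishes on inertia (`h38`, the tree's named fact
`Milne2006_localTamagawaNumber_smul_unramifiedClass_eq_zero`, discharged Summits-side), if `c` dies in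
`H¹(E', E)` then it dies in `H¹(K_v, E)`: its image is inflated from a cocycle vanishing on
`Γ_{Ẽ'} ⊇ I_𝔐`, killed by `c_v` (`h38`) and by `m`, hence zero. (The good-reduction case `c_v = 1` is
`mem_localRestrictionKer_of_tower_of_inertia_le`.) [cite: MilneADT2006, Ch. I Prop. 3.8]
[cite: Mazur1972, §4] [cite: SerreGaloisCohomology1997, I.§5.8] -/
theorem mem_localRestrictionKer_of_tower_of_inertia_le_of_isCoprime {K : Type u} [Field K] [NumberField K]
    {W : WeierstrassCurve K} [W.IsElliptic]
    (h38 : Milne2006_localTamagawaNumber_smul_unramifiedClass_eq_zero.{u})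
    {v : HeightOneSpectrum (𝓞 K)} {E' : Type u} [Field E'] [Algebra K E']
    [Algebra (v.adicCompletion K) E'] [IsScalarTower K (v.adicCompletion K) E']
    [FiniteDimensional (v.adicCompletion K) E'] {𝔐 : Ideal v.localAbsIntegers}
    (h𝔐 : 𝔐 ∈ v.localPrimesAbove)
    (hI : 𝔐.inertia (absoluteGaloisGroup (v.adicCompletion K)) ≤
      finGalSubgroup (E := v.adicCompletion K) E')
    {m : ℤ} (hcop : IsCoprime m
      ((W.baseChange (v.adicCompletion K)).localTamagawaNumber (v.adicCompletionIntegers K) : ℤ))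
    {c : W.galH1} (hmc : m • c = 0) (hc : c ∈ W.localRestrictionKer E') :
    c ∈ W.localRestrictionKer (v.adicCompletion K) := by
  let ι₁ : AlgebraicClosure K →ₐ[K] AlgebraicClosure (v.adicCompletion K) :=
    closureEmb (K := K) (v.adicCompletion K)
  let ι₂ : AlgebraicClosure (v.adicCompletion K) →ₐ[v.adicCompletion K] AlgebraicClosure E' :=
    closureEmb (K := v.adicCompletion K) E'
  rw [← WeierstrassCurve.localRestrictionKerOfEmb_eq_holds W E' ((ι₂.restrictScalars K).comp ι₁)]
    at hc
  change c ∈ resKer (resGalOfEmb ((ι₂.restrictScalars K).comp ι₁))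
    (pointsMapOfEmb W ((ι₂.restrictScalars K).comp ι₁)) (pointsMapOfEmb_smul W _) at hc
  rw [resKer_eq_ker, AddMonoidHom.mem_ker,
    resH1Hom_congr (resGalOfEmb_comp_tower ι₁ ι₂) (pointsMapOfEmb_comp_tower W ι₁ ι₂) _
      (fun x m ↦ by
        simp only [ContinuousMonoidHom.comp_toFun, AddMonoidHom.coe_comp, Function.comp_apply,
          pointsMapOfEmb_smul, pointsMapTower_smul]),
    ← resH1Hom_comp (resGalOfEmb ι₁) (pointsMapOfEmb W ι₁) (pointsMapOfEmb_smul W ι₁)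
      (resGalOfEmb (K := v.adicCompletion K) ι₂) _ (pointsMapTower_smul W ι₂), AddMonoidHom.comp_apply,
    ← AddMonoidHom.mem_ker, ← resKer_eq_ker] at hc
  -- the image of `c` in `H¹(K_v, E)` is inflated from a cocycle vanishing on `Γ_{Ẽ'} ⊇ I_𝔐`
  obtain ⟨f, hf⟩ := resKer_le_range_inflClass (resGalOfEmb (K := v.adicCompletion K) ι₂)
    (pointsMapTower W ι₂) (pointsMapTower_smul W ι₂) (pointsMapTower_bijective W ι₂)
    (finGalSubgroup (E := v.adicCompletion K) E') (isOpen_finGalSubgroup E')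
    (finGalSubgroup_le_range_resGal E') hc
  -- Milne I.3.8 (Tamagawa form): `c_v • [f] = 0`
  have hcv : ((W.baseChange (v.adicCompletion K)).localTamagawaNumber (v.adicCompletionIntegers K) : ℤ) •
      inflClass (localPoints W (v.adicCompletion K)) (finGalSubgroup (E := v.adicCompletion K) E')
        (isOpen_finGalSubgroup E') f = 0 := by
    rw [inflClass_apply]
    exact h38 W v h𝔐 _ fun σ hσ ↦ by
      rw [toContOneCocycle_apply]
      exact cocyclesVanishingOn.apply_of_mem f (hI hσ)
  -- `m • [f] = res (m • c) = 0`
  have hm : m • inflClass (localPoints W (v.adicCompletion K)) (finGalSubgroup (E := v.adicCompletion K) E')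
      (isOpen_finGalSubgroup E') f = 0 := by
    rw [hf, ← map_zsmul, hmc, map_zero]
  have h0 := eq_zero_of_zsmul_eq_zero_of_isCoprime hcop hm hcv
  change resH1Hom (resGalOfEmb ι₁) (pointsMapOfEmb W ι₁) (pointsMapOfEmb_smul W ι₁) c = 0
  rw [← hf, h0]

end Abstract

/-! ## §3 At the completions of a quadratic-type extension of number fields -/

section NumberField

variable {K : Type u} [Field K] [NumberField K] (W : WeierstrassCurve K)
variable (L : Type u) [Field L] [NumberField L] [Algebra K L] [Normal K L]

/-- **Unramified places of any reduction, classes of order prime to `c_v`: `H¹(K, E) → H¹(K_v, E)`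
and `→ H¹(L_w, E)` have the same kernel on them.** Let `L = K + K θ`, `θ² = c ∈ K`, be normal over
`K`, `v` a finite place of `K` UNRAMIFIED in `L`, `w ∣ v`, and `x ∈ H¹(K, E)` killed by `m` with
`gcd(m, c_v) = 1`; granted Milne I.3.8 in Tamagawa form (`h38`). If `x` dies in `H¹(L_w, E)` then it
dies in `H¹(K_v, E)`: the local inertia group fixes every copy of `L_w`
(`inertia_le_finGalSubgroup_adicCompletion_of_isUnramifiedIn`) and
`mem_localRestrictionKer_of_tower_of_inertia_le_of_isCoprime` applies. (Dokchitser–Dokchitser, proof of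
Lemma 4.14: at an unramified place the local term `H¹(Gal(L_w/K_v), E(L_w))` has order dividing a power
of `c_v` — Mazur 1972 — so it does not see classes of order prime to `c_v`.)
[cite: MilneADT2006, Ch. I Prop. 3.8] [cite: Mazur1972, §4]
[cite: DokchitserDokchitserAnnals2010, Lemma 4.14 (proof)] -/
theorem mem_localRestrictionKer_adicCompletion_of_isUnramifiedIn_of_isCoprime [W.IsElliptic]
    (h38 : Milne2006_localTamagawaNumber_smul_unramifiedClass_eq_zero.{u}) {θ : L} {c : K}
    (hθ : θ ^ 2 = algebraMap K L c)
    (hL : ∀ x : L, ∃ a b : K, x = algebraMap K L a + algebraMap K L b * θ)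
    {v : HeightOneSpectrum (𝓞 K)} (hunr : Algebra.IsUnramifiedIn (𝓞 L) v.asIdeal)
    (w : HeightOneSpectrum (𝓞 L)) [w.asIdeal.LiesOver v.asIdeal]
    {m : ℤ} (hcop : IsCoprime m
      ((W.baseChange (v.adicCompletion K)).localTamagawaNumber (v.adicCompletionIntegers K) : ℤ))
    {x : W.galH1} (hmx : m • x = 0) (hx : x ∈ W.localRestrictionKer (w.adicCompletion L)) :
    x ∈ W.localRestrictionKer (v.adicCompletion K) := by
  letI : Algebra (v.adicCompletion K) (w.adicCompletion L) :=
    (adicCompletionMap (K := K) L v w).toAlgebra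
  haveI : IsScalarTower K (v.adicCompletion K) (w.adicCompletion L) :=
    IsScalarTower.of_algebraMap_eq fun x ↦ (adicCompletionMap_coe (K := K) L v w x).symm
  haveI : FiniteDimensional (v.adicCompletion K) (w.adicCompletion L) :=
    (finrank_adicCompletion_le_of_liesOver L v w).1
  obtain ⟨𝔐, h𝔐⟩ := v.localPrimesAbove_nonempty
  have hI := inertia_le_finGalSubgroup_adicCompletion_of_isUnramifiedIn L hθ hL hunr w rfl h𝔐
  exact mem_localRestrictionKer_of_tower_of_inertia_le_of_isCoprime h38 h𝔐 hI hcop hmx hx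

omit [Normal K L] in
/-- **Any place, granted unique `n`-divisibility of `E(K̄_v)^{Γ_{L̃_w}}`: `H¹(K, E) → H¹(K_v, E)` and
`→ H¹(L_w, E)` have the same kernel on `n`-torsion classes** (`w ∣ v` finite places of `L/K`; the
`K_v`-algebra structure on `L_w` is the map of completions). The number-field instance of
`mem_localRestrictionKer_of_tower_of_fixedPoints_divisible`; its two hypotheses hold at `w ∤ n` as soon
as `E(L_w)[n] = 0` (Milne I Lemma 3.3: `#E(L_w)/n E(L_w) = #E(L_w)[n] · #(𝓞_w/n)`), in particular at the
RAMIFIED places of `L/K` away from `n` where `E(K_v)` has no `n`-torsion and `[L_w : K_v]` is a power of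
the prime dividing `n`. [cite: MilneADT2006, Ch. I Lemma 3.3]
[cite: DokchitserDokchitserAnnals2010, Lemma 4.14 (proof)] -/
theorem mem_localRestrictionKer_adicCompletion_of_fixedPoints_divisible {n : ℤ}
    {v : HeightOneSpectrum (𝓞 K)} (w : HeightOneSpectrum (𝓞 L)) [w.asIdeal.LiesOver v.asIdeal]
    (htf : letI : Algebra (v.adicCompletion K) (w.adicCompletion L) :=
        (adicCompletionMap (K := K) L v w).toAlgebra
      ∀ a : localPoints W (v.adicCompletion K),
        (∀ g ∈ finGalSubgroup (E := v.adicCompletion K) (w.adicCompletion L), g • a = a) →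
          n • a = 0 → a = 0)
    (hdiv : letI : Algebra (v.adicCompletion K) (w.adicCompletion L) :=
        (adicCompletionMap (K := K) L v w).toAlgebra
      ∀ a : localPoints W (v.adicCompletion K),
        (∀ g ∈ finGalSubgroup (E := v.adicCompletion K) (w.adicCompletion L), g • a = a) →
          ∃ b : localPoints W (v.adicCompletion K),
            (∀ g ∈ finGalSubgroup (E := v.adicCompletion K) (w.adicCompletion L), g • b = b) ∧ n • b = a)
    {x : W.galH1} (hnx : n • x = 0) (hx : x ∈ W.localRestrictionKer (w.adicCompletion L)) :
    x ∈ W.localRestrictionKer (v.adicCompletion K) := by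
  letI : Algebra (v.adicCompletion K) (w.adicCompletion L) :=
    (adicCompletionMap (K := K) L v w).toAlgebra
  haveI : IsScalarTower K (v.adicCompletion K) (w.adicCompletion L) :=
    IsScalarTower.of_algebraMap_eq fun x ↦ (adicCompletionMap_coe (K := K) L v w x).symm
  haveI : FiniteDimensional (v.adicCompletion K) (w.adicCompletion L) :=
    (finrank_adicCompletion_le_of_liesOver L v w).1
  haveI : CharZero (v.adicCompletion K) :=
    charZero_of_injective_algebraMap (algebraMap K (v.adicCompletion K)).injective
  exact mem_localRestrictionKer_of_tower_of_fixedPoints_divisible (E := v.adicCompletion K) htf hdiv hnx hx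

end NumberField

/-! ## §4 Global assembly: `res x ∈ Sel^(n)(E_L/L) ⟹ x ∈ Sel^(n)(E/K)` from the local kernels -/

section Global

-- `Type 0`, as the tree's archimedean local condition (`localRestrictionKer_eq_top_of_isAlgClosed`).
variable {K : Type} [Field K] [NumberField K] (W : WeierstrassCurve K)
variable (L : Type) [Field L] [NumberField L] [Algebra K L] (n : ℤ)

/-- **Exact descent of the `n`-Selmer condition, assembled from the places.** For `K` totally
complex, `x ∈ H¹(K, E[n])` with `res x ∈ Sel^(n)(E_L/L)`, and, at every finite place `v` of `K`, some
place `w ∣ v` of `L` at which "the image `c` of `x` in `H¹(K, E)` dies over `L_w` ⟹ `c` dies over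
`K_v`" (`hloc`: split places and unramified good places by `LocalRestrictionUnramifiedDescentProofs`;
unramified bad places with `gcd(n, c_v) = 1` and uniquely-`n`-divisible places by §§2–3): then
`x ∈ Sel^(n)(E/K)`. The Selmer groups are the preimages of `Ш` (`selmerGroup_eq_comap_sha`), `Ш` is cut
out place by place (`mem_sha_iff`), restriction commutes with `H¹(·, E[n]) → H¹(·, E)`
(`torsionH1ToH1_resTorsion`) and local conditions correspond under restriction
(`mem_localRestrictionKer_iff_resBaseChange_mem`); at the (complex) infinite places there is no
condition (`localRestrictionKer_eq_top_of_isAlgClosed`). [cite: DokchitserDokchitserAnnals2010, Lemma 4.14 (proof)]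
[cite: MilneADT2006, Ch. I §6] -/
theorem mem_selmerGroup_of_resTorsion_mem_of_forall (hK : ∀ v : InfinitePlace K, v.IsComplex)
    {x : galH1Torsion W n}
    (hloc : ∀ v : HeightOneSpectrum (𝓞 K), ∃ (w : HeightOneSpectrum (𝓞 L))
      (_ : w.asIdeal.LiesOver v.asIdeal),
      torsionH1ToH1 W n x ∈ W.localRestrictionKer (w.adicCompletion L) →
        torsionH1ToH1 W n x ∈ W.localRestrictionKer (v.adicCompletion K))
    (hx : resTorsion W L n x ∈ selmerGroup (W.baseChange L) n) : x ∈ selmerGroup W n := by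
  rw [selmerGroup_eq_comap_sha, AddSubgroup.mem_comap] at hx ⊢
  rw [torsionH1ToH1_resTorsion] at hx
  rw [WeierstrassCurve.mem_sha_iff] at hx ⊢
  refine ⟨fun v ↦ ?_, fun v ↦ ?_⟩
  · obtain ⟨w, hw, himp⟩ := hloc v
    haveI := hw
    exact himp ((mem_localRestrictionKer_iff_resBaseChange_mem W _).mpr (hx.1 w))
  · haveI : IsAlgClosed v.Completion :=
      isAlgClosed_of_ringEquiv (InfinitePlace.Completion.ringEquivComplexOfIsComplex (hK v)).symm
    rw [localRestrictionKer_eq_top_of_isAlgClosed]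
    trivial

/-- **`x ∈ Sel^(n)(E/K) ⟺ res x ∈ Sel^(n)(E_L/L)`** under the hypotheses of
`mem_selmerGroup_of_resTorsion_mem_of_forall` (the forward direction is the tree's
`resTorsion_mem_selmerGroup`). [cite: DokchitserDokchitserAnnals2010, Lemma 4.14 (proof)] -/
theorem mem_selmerGroup_iff_resTorsion_mem_of_forall (hK : ∀ v : InfinitePlace K, v.IsComplex)
    {x : galH1Torsion W n}
    (hloc : ∀ v : HeightOneSpectrum (𝓞 K), ∃ (w : HeightOneSpectrum (𝓞 L))
      (_ : w.asIdeal.LiesOver v.asIdeal),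
      torsionH1ToH1 W n x ∈ W.localRestrictionKer (w.adicCompletion L) →
        torsionH1ToH1 W n x ∈ W.localRestrictionKer (v.adicCompletion K)) :
    x ∈ selmerGroup W n ↔ resTorsion W L n x ∈ selmerGroup (W.baseChange L) n :=
  ⟨resTorsion_mem_selmerGroup W L n, mem_selmerGroup_of_resTorsion_mem_of_forall W L n hK hloc⟩

omit [NumberField K] in
/-- The image of an `n`-torsion class in `H¹(K, E)` is killed by `n` (for the coprimality / divisibility
hypotheses of §§2–3). [cite: SilvermanAEC2009, X.§4 diagram (**)] -/
theorem zsmul_torsionH1ToH1_eq_zero (x : galH1Torsion W n) : n • torsionH1ToH1 W n x = 0 := by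
  rw [← map_zsmul, zsmul_discreteH1_torsion n x, map_zero]

end Global

end Literature.NumberTheory.EllipticCurves
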